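import Mathlib
import Summits.Ventures.HodgeRepro.Tier4.Line4.TailGlueMain
import Summits.Ventures.HodgeRepro.Tier4.Line4.RatioGlue

/-!
# Tier4/Line4/TailGlueRatio — C-L4-TAIL-GLUE-3: the (7b) glue with (S-RATIO) discharged by name

Blind re-derivation cell `pub-hodge-repro`, Tier 4 «prove the step» (README §9–§10), LINE L4, seat t4-x2 (g5, reserve
wall-breaker; after L1-p4 g5's RatioGlue p711153, S15774/S15776: «TailGlue's `hratio` = `hratio_of_pieces` VERBATIM — the glue
binds it by name»).  Tree path `lean/Summits/Ventures/HodgeRepro/Tier4/Line4/TailGlueRatio.lean`.  Imports `Line4/TailGlueMain`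
(p710216) and L1-p4's `Line4/RatioGlue` (`hratio_of_pieces`; through it L4-p2's LevelIndexCount `exists_finset_cover_levelDoubleCoset`).
Mathlib-level; no literature; no `def`.

WHAT.  `exists_levelFamily_fibreDominated_of_displays_main` (TailGlueMain) binds (S-RATIO) as the hypothesis
`hratio : ∀ N γ, ¬ transporter γ → (suppMeasureFolded (p^(N+n₁)) γ).toReal ≤ C′ · (suppMeasure (p^(N+n₁)) γ₀).toReal` with
`0 < C′`.  L1-p4's `hratio_of_pieces` proves `∃ C′, …` from the (F) pieces — the double-coset cover (`hreps`, BY NAME here from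
`exists_finset_cover_levelDoubleCoset` at `ofFinPart γ₀` under `exists_levelPrime`'s integrality clause), the projection bound
`hproj` ((F-c), L1-p1), the unit currency `hunit` (`unit_of_currency_of_beta` ∘ (`hcur`, `hβ`)), and the finiteness `hfin`.  The
positivity `0 < C′` the glue needs is free: enlarge `C′` to `max C′ 1` (the right side is non-negative).

* `finPart_mat_ofFinPart_le_one_of_natSize` — the integrality clause of `exists_levelPrime` transported to `ofFinPart γ₀`, in the
  `(p : 𝓞 k) ∈ v.asIdeal` form of `exists_finset_cover_levelDoubleCoset`.
* `hreps_of_natSize_lt_one` — the cover `hreps` along `p ^ (n + n₁)`, by name.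
* **`exists_levelFamily_fibreDominated_of_displays_ratio`** — the glue with (S-IDX), (S-MAIN) and (S-RATIO) by name: (7b) is a
  theorem modulo (S-SEP) (S-UNIT) (S-COUNT) (S-SPARSE) + `harch` + (S-FIN-NV) + `ChainInputs` + the (F) pieces `hproj`/`hunit`/`hfin`.

Nothing here says anything about the status of the Hodge conjecture for CM abelian varieties, which is NOT proved
(HC_CM is NOT proved by anyone in this repository).
-/

set_option autoImplicit false

noncomputable section

namespace Summit.Ventures.HodgeRepro.Tier4.Line4

open MeasureTheory Topology Filter NumberField IsDedekindDomain Summit.Ventures.HodgeRepro.Tier4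
  Summit.Ventures.HodgeRepro.Tier4.Common Summit.Ventures.HodgeRepro.Tier4.Line1
  Summit.Ventures.HodgeRepro.Tier4.Line1.RTF Summit.Ventures.HodgeRepro.Tier4.Line4.L1Class

open scoped NumberField NNReal ENNReal Pointwise

section Cover

variable {k : Type} [Field k] [NumberField k] (W : PlaneData k)

/-- The integrality clause of `exists_levelPrime` at the rational `γ₀`, transported to `ofFinPart γ₀` in the `v ∣ p` form. -/
theorem finPart_mat_ofFinPart_le_one_of_natSize (γ₀ : GA W) (p : ℕ)
    (hγ₀ : ∀ v : HeightOneSpectrum (𝓞 k), natSize k v p < 1 → ∀ i j : Fin 4,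
      Valued.v (finPart k (GA.mat W γ₀ i j) v) ≤ 1 ∧ Valued.v (finPart k (GA.mat W γ₀⁻¹ i j) v) ≤ 1) :
    (∀ v : HeightOneSpectrum (𝓞 k), (p : 𝓞 k) ∈ v.asIdeal → ∀ i j : Fin 4,
      Valued.v (finPart k (GA.mat W (GA.ofFinPart W γ₀) i j) v) ≤ 1) ∧
    (∀ v : HeightOneSpectrum (𝓞 k), (p : 𝓞 k) ∈ v.asIdeal → ∀ i j : Fin 4,
      Valued.v (finPart k (GA.mat W (GA.ofFinPart W γ₀)⁻¹ i j) v) ≤ 1) := by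
  constructor
  · intro v hv i j
    rw [finPart_mat_ofFinPart]
    exact (hγ₀ v ((natSize_lt_one_iff_mem v p).mpr hv) i j).1
  · intro v hv i j
    rw [← ofFinPart_inv, finPart_mat_ofFinPart]
    exact (hγ₀ v ((natSize_lt_one_iff_mem v p).mpr hv) i j).2

/-- **The double-coset cover along `p ^ (n + n₁)` BY NAME** (L4-p2's `exists_finset_cover_levelDoubleCoset` at `ofFinPart γ₀`):
the `hreps` binder of RatioGlue. -/
theorem hreps_of_natSize_lt_one (γ₀ : GA W) (p n₁ : ℕ)
    (hγ₀ : ∀ v : HeightOneSpectrum (𝓞 k), natSize k v p < 1 → ∀ i j : Fin 4,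
      Valued.v (finPart k (GA.mat W γ₀ i j) v) ≤ 1 ∧ Valued.v (finPart k (GA.mat W γ₀⁻¹ i j) v) ≤ 1) :
    ∃ M₁ : ℕ, ∀ n, ∃ reps : Finset (GA W), reps.card ≤ M₁ ∧
      levelDoubleCoset W (p ^ (n + n₁)) (GA.ofFinPart W γ₀) ⊆
        ⋃ g ∈ reps, g • (levelK W (p ^ (n + n₁)) : Set (GA W)) := by
  obtain ⟨h1, h2⟩ := finPart_mat_ofFinPart_le_one_of_natSize W γ₀ p hγ₀
  obtain ⟨M, hM⟩ := exists_finset_cover_levelDoubleCoset W (ofFinPart_mem_finitePart W γ₀) p h1 h2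
  exact ⟨M, fun n => hM (n + n₁)⟩

end Cover

section Glue3

variable {k : Type} [Field k] [NumberField k] (W : PlaneData k) [MeasurableSpace (GA W)] [BorelSpace (GA W)]
  (R : RTFData W) (μ : Measure (GA W)) [μ.IsHaarMeasure] [R.μT.IsHaarMeasure] [R.μT'.IsHaarMeasure]
  (DG : Set (GA W)) (fdG : IsFundamentalDomain (rationalPoints W) DG μ) (compG : IsCompact (closure DG))
  (compT : IsCompact (closure R.DT)) (compT' : IsCompact (closure R.DT'))

/-- **THE (7b) GLUE WITH (S-IDX), (S-MAIN) AND (S-RATIO) BY NAME**: (S-RATIO) through L1-p4's `hratio_of_pieces` from the (F)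
pieces `hproj` / `hunit` / `hfin` (the cover `hreps` by name from the integrality clause already present); the positivity of
the ratio constant is obtained by enlarging it to `max C′ 1`. -/
theorem exists_levelFamily_fibreDominated_of_displays_ratio [MeasurableMul (torusT W)] [MeasurableMul (torusT' W)]
    (hRH : R.IsHaar)
    (hc : Continuous R.chi) (hu : ∀ a, ‖R.chi a‖ = 1) (hc' : Continuous R.chi') (hu' : ∀ a, ‖R.chi' a‖ = 1)
    (q : QuadData k) (g g' : Matrix (Fin 4) (Fin 4) k) (w₀ : InfinitePlace k) (eP eM eP' eM' : InfinitePlace k → ℤ)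
    (γ₀ : rationalPoints W) (hreg : IsRegularRational W γ₀)
    (νinf : Measure (torusInf W)) [νinf.IsHaarMeasure] [IsFiniteMeasure νinf]
    (νf : Measure (torusFin W)) [νf.IsHaarMeasure]
    (c : ℝ≥0) (hc0 : 0 < c) (hcμ : R.μT = c • Measure.map (torusSplit W).symm (νinf.prod νf))
    (νinf' : Measure (torusInf' W)) [νinf'.IsHaarMeasure] [IsFiniteMeasure νinf']
    (νf' : Measure (torusFin' W)) [νf'.IsHaarMeasure]
    (c' : ℝ≥0) (hc0' : 0 < c') (hcμ' : R.μT' = c' • Measure.map (torusSplit' W).symm (νinf'.prod νf'))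
    (DZf : Set (torusFin W)) (hDZf : MeasurableSet DZf) (hfd : IsFundamentalDomain (centreFin W) DZf νf)
    (μinf : Measure (infinitePart W)) [μinf.IsHaarMeasure] (μ₀ : Measure (finitePart W)) [μ₀.IsHaarMeasure]
    (c₀ : ℝ≥0) (hc₀ : 0 < c₀) (hcμ₀ : μ = c₀ • Measure.map (gaSplit W).symm (μinf.prod μ₀))
    (finf : GA W → ℂ)
    (hfinf : IsArchCoeffD W (Setting.ofAdelicData W R μ DG fdG compG compT compT') R q g g' w₀ eP eM eP' eM'
      (γ₀ : GA W) νinf νinf' finf)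
    {e : GA W → ℂ} (he : IsInfFactor W e)
    (hequiv : ∀ (w : InfinitePlace k) (κ : GA W), κ ∈ localTorusAt' W w → ∀ x,
      e (x * κ) = weightAt' W q w g g' 0 κ ^ (-eP' w) * weightAt' W q w g g' 1 κ ^ (-eM' w) * e x)
    (harch : L1Class.archFactor W R (convInf W μinf finf e) (γ₀ : GA W) νinf νinf' ≠ 0)
    (p n₁ : ℕ) (hp : p.Prime)
    (hγ₀ : ∀ v : HeightOneSpectrum (𝓞 k), natSize k v p < 1 → ∀ i j : Fin 4,
      Valued.v (finPart k (GA.mat W (γ₀ : GA W) i j) v) ≤ 1 ∧ Valued.v (finPart k (GA.mat W (γ₀ : GA W)⁻¹ i j) v) ≤ 1)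
    (hsep : ∀ n ≥ n₁, ∀ γ : rationalPoints W,
      (torusT W).map (MulAut.conj ((γ : GA W))⁻¹).toMonoidHom = torusT' W →
      ∀ t ∈ torusT W, ∀ t' ∈ torusT' W,
        GA.ofFinPart W (t⁻¹ * (γ : GA W) * t') ∉ levelDoubleCoset W (p ^ n) (GA.ofFinPart W (γ₀ : GA W)))
    -- the (F) pieces of (S-RATIO) (RatioGlue's binders)
    (u : ℕ → ℝ≥0∞) (κ : ℝ≥0∞) (hκ : κ ≠ ⊤)
    (hproj : ∀ (n : ℕ) (γ : GA W),
      νf (finTf W '' closure R.DT ∩ projSet W (γ₀ : GA W) (p ^ (n + n₁)) γ) ≤ κ * u n)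
    (M₂ : ℝ≥0∞) (hM₂ : M₂ ≠ ⊤)
    (hunit : ∀ n, u n * νf' (levelTf' W (p ^ (n + n₁))) ≤
      M₂ * suppMeasure W νf νf' (γ₀ : GA W) DZf (p ^ (n + n₁)) (γ₀ : GA W))
    (hfin : ∀ n, suppMeasure W νf νf' (γ₀ : GA W) DZf (p ^ (n + n₁)) (γ₀ : GA W) ≠ ⊤)
    (hv : ∀ N : ℕ, 0 < (suppMeasure W νf νf' (γ₀ : GA W) DZf (p ^ (N + n₁)) (γ₀ : GA W)).toReal)
    (hcount : SublevelCount₀ W (Setting.ofAdelicData W R μ DG fdG compG compT compT'))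
    (gth : ℕ → ℝ) (hg : Tendsto gth atTop atTop)
    (hR : ∀ (N : ℕ) (γ : (Setting.ofAdelicData W R μ DG fdG compG compT compT').Gk),
      (Setting.ofAdelicData W R μ DG fdG compG compT compT').orbitOf γ ∉
        ({(Setting.ofAdelicData W R μ DG fdG compG compT compT').orbitOf γ₀} :
          Finset (Setting.ofAdelicData W R μ DG fdG compG compT compT').Orbit) →
      (∃ t ∈ R.DT, ∃ t' ∈ R.DT',
        (Setting.ofAdelicData W R μ DG fdG compG compT compT').conv
          (prodFn W finf (ffinMuNat W μ₀ (γ₀ : GA W) (fun n => p ^ (n + n₁)) (p ^ (N + n₁))))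
          (testNat W e (p ^ (N + n₁))) ((t : GA W)⁻¹ * γ * (t' : GA W)) ≠ 0) →
      gth N ≤ archDist W (γ : GA W))
    (hnv : ∃ δ : ℝ, 0 < δ ∧ ∃ N₀ : ℕ, ∀ N ≥ N₀,
      δ * (suppMeasure W νf νf' (γ₀ : GA W) DZf (p ^ (N + n₁)) (γ₀ : GA W)).toReal ≤
        ‖∫ b in DZf, R.chi b * innerFin W R (levelDC W (γ₀ : GA W) (p ^ (N + n₁))) (γ₀ : GA W) νf' b ∂νf‖)
    (hchain : ∀ N : ℕ, ChainInputs W R γ₀ νinf νf νinf' νf' DZf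
      ((Setting.ofAdelicData W R μ DG fdG compG compT compT').conv
        (prodFn W finf (ffinMuNat W μ₀ (γ₀ : GA W) (fun n => p ^ (n + n₁)) (p ^ (N + n₁))))
        (testNat W e (p ^ (N + n₁))))
      (fun x => (c₀ : ℂ) * convInf W μinf finf e x) (levelDC W (γ₀ : GA W) (p ^ (N + n₁)))) :
    ∃ lev : ℕ → ℕ, (∀ n, lev n ≠ 0) ∧
    ∃ ffin f₂ : ℕ → GA W → ℂ, TailFamily' W q g g' eP' eM' (γ₀ : GA W) ffin f₂ ∧
      ∃ E : Finset (Setting.ofAdelicData W R μ DG fdG compG compT compT').Orbit,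
        (Setting.ofAdelicData W R μ DG fdG compG compT compT').orbitOf γ₀ ∈ E ∧
        FibreDominatedFrom (Setting.ofAdelicData W R μ DG fdG compG compT compT') R.chi R.chi' E
          (fun n => (Setting.ofAdelicData W R μ DG fdG compG compT compT').conv
            (prodFn W finf (ffin (lev n))) (f₂ (lev n))) := by
  obtain ⟨M₁, hreps⟩ := hreps_of_natSize_lt_one W (γ₀ : GA W) p n₁ hγ₀
  obtain ⟨C', hC'⟩ := hratio_of_pieces W R hRH compT compT' νinf νf c hcμ νinf' νf' c' hcμ' (γ₀ : GA W) DZf p n₁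
    hp.ne_zero M₁ hreps u κ hκ hproj M₂ hM₂ hunit hfin
  have hpos : (0 : ℝ) < max C' 1 := lt_of_lt_of_le one_pos (le_max_right _ _)
  have hratio : ∀ (N : ℕ) (γ : rationalPoints W),
      ¬ ((torusT W).map (MulAut.conj ((γ : GA W))⁻¹).toMonoidHom = torusT' W) →
      (suppMeasureFolded W R (γ₀ : GA W) (p ^ (N + n₁)) (γ : GA W)).toReal ≤
        max C' 1 * (suppMeasure W νf νf' (γ₀ : GA W) DZf (p ^ (N + n₁)) (γ₀ : GA W)).toReal := fun N γ hγ =>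
    (hC' N γ hγ).trans (mul_le_mul_of_nonneg_right (le_max_left _ _) ENNReal.toReal_nonneg)
  exact exists_levelFamily_fibreDominated_of_displays_main W R μ DG fdG compG compT compT' hRH hc hu hc' hu' q g g' w₀
    eP eM eP' eM' γ₀ hreg νinf νf c hc0 hcμ νinf' νf' c' hc0' hcμ' DZf hDZf hfd μinf μ₀ c₀ hc₀ hcμ₀ finf hfinf he hequiv
    harch p n₁ hp hγ₀ hsep (max C' 1) hpos hratio hv hcount gth hg hR hnv hchain

end Glue3

end Summit.Ventures.HodgeRepro.Tier4.Line4

end
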